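import Literature.Probability.TransportMaps.DobrushinPecherskyContraction
import Literature.Probability.TransportMaps.DobrushinPecherskySweep
import HarnessLib

/-!
# The Dobrushin–Pechersky criterion, quantitative core: repeated sweeps contract `γ` at a geometric
# rate below the threshold (Conache–Kondratiev–Kozitsky–Pasurek 2015, proof of Theorem 2.6, (28a), (18))

[topic Probability/TransportMaps]

[ConacheEtAl2015] D. Conache, Yu. Kondratiev, Yu. Kozitsky, T. Pasurek, arXiv:1501.00673, after
[DobrushinPechersky1983]. Proof of Theorem 2.6 (§3.3, verbatim): «we let `ν̂₁ ∈ 𝒞(μ₁, μ₂)` and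
`ν̂₀ ∈ 𝒞(μ₁, μ₂)` be the measures on the left-hand sides and right-hand sides of (27) and (28) …
We repeat this due times and obtain `ν̂ₙ ∈ 𝒞(μ₁, μ₂)` such that
(28a) `(γ(ν̂ₙ), λ(ν̂ₙ))ᵀ ≤ [M(K)]ⁿ (γ(ν₀), λ(ν₀))ᵀ` … For `K > K_*` … we have `r_K < 1`, which by
(28a) yields (18)» — (18): `γ(ν̂ₙ) = sup_ℓ ∫ υ(x¹_ℓ, x²_ℓ) ν̂ₙ(dx¹, dx²) → 0`.

THIS FILE composes the two abstract halves already in the tree: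
the sweep (`DobrushinPecherskySweep`: `DPSystem.sweep`, `lemma_3_7`, `iterate_recursion`) and the
`2 × 2` contraction (`DobrushinPecherskyContraction`: `fst_iterate_le`, `exists_weight_ennreal`,
`perronRoot_lt_one_iff`):
* `iterate_γ_le` — for ANY weight `ξ` and rate `r` with the two row conditions of the conjugated
  matrix, `γ(ν̂ₙ) ≤ rⁿ · max{γ(ν₀), ξ⁻¹ λ(ν₀)}` (the shape of (dc12) for the full sweep);
* ★ `exists_rate_lt_one` — below the threshold
  `κ̄ + α < 1`, `c̄Δ^{χ+1} < 1`, `2α · Δ^χ < (1 − κ̄ − α)(1 − c̄Δ^{χ+1})` (`α = AK⁻¹ > 0`)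
  there are `r < 1` (the Perron root of `[[κ̄ + α, 2α], [Δ^χ, c̄Δ^{χ+1}]]`) and `ξ > 0` with
  `γ(ν̂ₙ) ≤ rⁿ · max{γ(ν₀), ξ⁻¹ λ(ν₀)}` for all `n` — (28a) ⟹ (18) quantitatively.

READING NOTE (E-DP-1, see the Sweep file): the second row used here is `(Δ^χ, c̄Δ^{χ+1})`, the one
§4 of print actually proves, not the printed `(Δ^{χ−1}, c̄Δ^χ)` of (28); accordingly the threshold is
the printed `K > K_*` ∕ `c̄ < Δ^{−χ}` with `χ` replaced by `χ + 1` in the second row's entries.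
What is NOT here: the measure-theoretic end of Theorem 2.6 (the `𝔏`-limit `ν_*` and Lemma 3.1,
`γ(ν_*) = 0 ⟹ μ₁ = μ₂`) and Theorem 2.7 (regional Lemma 3.8) — both need the state to be actual
couplings and are left to the instance files. Nothing about lattice gauge theory or mass gaps.
No named facts.

## References
* [ConacheEtAl2015] arXiv:1501.00673, §3.3 (26a)–(28a), (srM), proof of Theorem 2.6; §3.4 (dc11).
* [DobrushinPechersky1983] LNM 1021 (1983) 97–110.
-/

noncomputable section

open scoped ENNReal NNReal

namespace Literature.Probability.TransportMaps

namespace DobrushinPecherskySweep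

namespace DPSystem

variable {ι : Type*} {St : Type*} {A : Type*} [Fintype A] [Fintype ι] {S : DPSystem ι St A}
  {χ : ℕ}

/-- `γ(ν̂ₙ)`: the sup of `ν̂ₙ(I_ℓ)` after `n` sweeps. [cite: ConacheEtAl2015, §3.2 (18), §3.3 (28a)] -/
def γIter (S : DPSystem ι St A) (col : ι → Fin χ) (ν : St) (n : ℕ) : ℝ≥0∞ :=
  ⨆ ℓ, S.γf ((S.sweep col)^[n] ν) ℓ

/-- `λ(ν̂ₙ)`: the sup of `ν̂ₙ(I_ℓ H^i_{ℓ'})` after `n` sweeps. [cite: ConacheEtAl2015, §3.2 (26), §3.3 (28a)] -/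
def ΛIter (S : DPSystem ι St A) (col : ι → Fin χ) (ν : St) (n : ℕ) : ℝ≥0∞ :=
  ⨆ p : A × ι × ι, S.Λ ((S.sweep col)^[n] ν) p.1 p.2.1 p.2.2

/-- **(28a) + (dc11): the contraction of `γ` along repeated sweeps**, for any conjugating weight
`0 < ξ < ∞` and rate `r` with `(κ̄ + α) + ξ·2α ≤ r` and `Δ^χ + ξ·c̄Δ^{χ+1} ≤ ξ r`:
`γ(ν̂ₙ) ≤ rⁿ · max{γ(ν₀), ξ⁻¹ λ(ν₀)}`. [cite: ConacheEtAl2015, §3.3 (28a), §3.4 (dc11)–(dc12)] -/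
theorem iterate_γ_le (h : S.IsDPStep) {Δ : ℕ} {κbar cbar α : ℝ≥0}
    (hA : S.Admissible Δ χ κbar cbar α) {col : ι → Fin χ}
    (hcol : ∀ ℓ, ∀ ℓ' ∈ S.nbr ℓ, col ℓ' ≠ col ℓ) (ν : St) {r ξ : ℝ≥0∞} (hξ0 : ξ ≠ 0)
    (hξt : ξ ≠ ∞) (hrow₁ : ((κbar : ℝ≥0∞) + α) + ξ * (2 * (α : ℝ≥0∞)) ≤ r)
    (hrow₂ : (Δ : ℝ≥0∞) ^ χ + ξ * ((cbar : ℝ≥0∞) * (Δ : ℝ≥0∞) ^ (χ + 1)) ≤ ξ * r) (n : ℕ) :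
    S.γIter col ν n ≤ r ^ n * max (S.γIter col ν 0) (ξ⁻¹ * S.ΛIter col ν 0) := by
  refine DobrushinPecherskyContraction.fst_iterate_le hξ0 hξt hrow₁ hrow₂ (S.γIter col ν)
    (S.ΛIter col ν) (fun k => ?_) (fun k => ?_) n
  · simpa [γIter, ΛIter, mul_assoc] using (S.iterate_recursion h hA hcol ν k).1
  · simpa [γIter, ΛIter, mul_assoc] using (S.iterate_recursion h hA hcol ν k).2

/-- **Theorem 2.6, quantitative core ((28a) ⟹ (18)).** Below the threshold — `κ̄ + α < 1`,
`c̄Δ^{χ+1} < 1` and `2α·Δ^χ < (1 − κ̄ − α)(1 − c̄Δ^{χ+1})`, with `α = AK⁻¹ > 0` — there are a rate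
`r < 1` (the Perron root `½[a + d + √((a − d)² + 4bc)]` of `[[κ̄ + α, 2α], [Δ^χ, c̄Δ^{χ+1}]]`, the
shape of (srM)) and a weight `ξ > 0` such that for every initial state and every `n`,
`γ(ν̂ₙ) ≤ rⁿ · max{γ(ν₀), ξ⁻¹ λ(ν₀)}`; in particular `γ(ν̂ₙ) → 0` when `γ(ν₀), λ(ν₀) < ∞` («we have
`r_K < 1`, which by (28a) yields (18)»). The printed threshold reads the same with the printed second
row `(Δ^{χ−1}, c̄Δ^χ)`; see the reading note E-DP-1. [cite: ConacheEtAl2015, Theorem 2.6 (proof, §3.3), (srM), (18)] -/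
theorem exists_rate_lt_one (h : S.IsDPStep) {Δ : ℕ} {κbar cbar α : ℝ≥0}
    (hA : S.Admissible Δ χ κbar cbar α) {col : ι → Fin χ}
    (hcol : ∀ ℓ, ∀ ℓ' ∈ S.nbr ℓ, col ℓ' ≠ col ℓ) (hα : 0 < α) (h1 : κbar + α < 1)
    (h2 : cbar * (Δ : ℝ≥0) ^ (χ + 1) < 1)
    (h3 : 2 * α * (Δ : ℝ≥0) ^ χ < (1 - (κbar + α)) * (1 - cbar * (Δ : ℝ≥0) ^ (χ + 1))) :
    ∃ r ξ : ℝ≥0, (r : ℝ) = DobrushinPecherskyContraction.perronRoot (κbar + α) (2 * α)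
        ((Δ : ℝ) ^ χ) (cbar * (Δ : ℝ) ^ (χ + 1)) ∧ r < 1 ∧ 0 < ξ ∧
      ∀ (ν : St) (n : ℕ),
        S.γIter col ν n ≤ (r : ℝ≥0∞) ^ n * max (S.γIter col ν 0) ((ξ : ℝ≥0∞)⁻¹ * S.ΛIter col ν 0) := by
  have hb : (0 : ℝ≥0) < 2 * α := by positivity
  have hΔ : (0 : ℝ≥0) < (Δ : ℝ≥0) := by
    have := hA.two_le; exact_mod_cast (show 0 < Δ by omega)
  have hc : (0 : ℝ≥0) < (Δ : ℝ≥0) ^ χ := pow_pos hΔ χ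
  obtain ⟨r, ξ, hr, hξ0, hξt, hrow₁, hrow₂, hiff⟩ :=
    DobrushinPecherskyContraction.exists_weight_ennreal (κbar + α) (2 * α) ((Δ : ℝ≥0) ^ χ)
      (cbar * (Δ : ℝ≥0) ^ (χ + 1)) hb hc
  have hr1 : r < 1 := by
    have := hiff.2 ⟨h1, h2, h3⟩
    exact_mod_cast this
  have hξpos : 0 < ξ := pos_iff_ne_zero.2 fun h0 => hξ0 (by simp [h0])
  refine ⟨r, ξ, by simpa using hr, hr1, hξpos, fun ν n => ?_⟩
  refine S.iterate_γ_le h hA hcol ν hξ0 hξt ?_ ?_ n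
  · exact_mod_cast hrow₁
  · exact_mod_cast hrow₂

end DPSystem

end DobrushinPecherskySweep

end Literature.Probability.TransportMaps
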